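import Mathlib
import Summits.Schanuel.Schanuel.Theorems.SoloInformedExpAutomorphismDoorLogs
import Summits.Schanuel.Schanuel.Theorems.SoloInformedExpPolyOrbit

/-!
# The automorphism door, III: shear-and-twist — the pair `(log 2, √2 log 2)`

Soloist seat `solo-Schanuel-informed`, session 9 (atlas §2 E11 / door (F)); continues parts I–II
(`SoloInformedExpAutomorphismDoor`, `…DoorLogs`) with the engine `SoloInformedExpPolyOrbit`.

At the sixth emblematic pair `(log 2, √2 log 2)` of [Waldschmidt2000, §1.4] an endomorphism
`φ ∈ End(ℂ_exp)` translating `log 2` by `a ∈ 2πiℤ ∖ 0` and fixing `√2` does NOT fix the second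
exponential: `φ(2^{√2}) = 2^{√2}·u` with `u = e^{√2 a}`, `|u| = 1`, `u` of infinite order. The twist
helps rather than hurts (orbit lemma): **Theorem O (v)**
(`two_rpow_sqrt_two_indep_of_expEnd_moves_log_two`,
`schanuel_pair_log_two_sqrt_two_of_expEnd_moves`): if ONE endomorphism of `ℂ_exp` moves `log 2`,
then `2^{√2}` is algebraically independent from each of `log 2`, `π`, `e`, `log 3`, and Schanuel's
conjecture holds at `(log 2, √2 log 2)`; with parts I–II
(`schanuel_four_log_pairs_of_expEnd_moves_log_two`) the same single hypothesis decides SC(2) at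
ALL FOUR logarithmic emblematic pairs `(iπ, log 2)`, `(1, log 2)`, `(log 2, log 3)`,
`(log 2, √2 log 2)` — while at `(1, iπ)`, `(1, e)` every exp-endomorphism is inert (part I).

References as in parts I–II: [KMO2012] arXiv:1101.4224; [AK2025] arXiv:2405.01399 (§4 Case 1: in
Zilber's field automorphisms translate logarithms along `2πiℤ`); [Waldschmidt2000] §1.4.
-/

noncomputable section

open Complex IntermediateField
open scoped ComplexConjugate

namespace Summit.Schanuel.Schanuel.Theorems

/-! ### 3. Endomorphisms of `ℂ_exp`: normal form and the twisted pairs -/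

/-- Normalisation I: `ρ ∈ {σ, cσ}` commutes with `exp`, fixes `2πi`, and translates `log q` by a
non-zero multiple of `2πi` when `σ` moves it. [this file] -/
theorem exists_expEnd_fix_two_pi_I (σ : ℂ →+* ℂ) (hσ : ∀ z, σ (cexp z) = cexp (σ z))
    {ℓ : ℝ} {q : ℚ} (hℓ : Real.exp ℓ = q) (hmove : σ ℓ ≠ ℓ) :
    ∃ ρ : ℂ →+* ℂ, (∀ z, ρ (cexp z) = cexp (ρ z)) ∧ ρ (2 * Real.pi * I) = 2 * Real.pi * I ∧
      ∃ m : ℤ, m ≠ 0 ∧ ρ ℓ = ℓ + m * (2 * Real.pi * I) := by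
  obtain ⟨n, hn⟩ := expEnd_apply_log σ hσ hℓ
  have hn0 : n ≠ 0 := by
    rintro rfl
    apply hmove
    simpa using hn
  rcases expEnd_apply_two_pi_I σ hσ with hτ | hτ
  · exact ⟨σ, hσ, hτ, n, hn0, hn⟩
  · refine ⟨(starRingEnd ℂ).comp σ, ?_, ?_, -n, by simpa using hn0, ?_⟩
    · intro z
      rw [RingHom.comp_apply, RingHom.comp_apply, hσ, Complex.exp_conj]
    · rw [RingHom.comp_apply, hτ, map_neg]
      simp [map_mul, map_ofNat, Complex.conj_ofReal, Complex.conj_I]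
    · simp only [RingHom.comp_apply, hn, map_add, map_mul, map_intCast, map_ofNat,
        Complex.conj_ofReal, Complex.conj_I]
      push_cast
      ring

/-- Normalisation II: `φ = ρ²` commutes with `exp`, fixes `2πi`, `i`, `π`, every real `β` with
`β² ∈ ℚ`, and translates `log q` by a NON-ZERO multiple of `2πi`. [this file] -/
theorem exists_expEnd_normal_form (σ : ℂ →+* ℂ) (hσ : ∀ z, σ (cexp z) = cexp (σ z))
    {ℓ : ℝ} {q : ℚ} (hℓ : Real.exp ℓ = q) (hmove : σ ℓ ≠ ℓ) :
    ∃ φ : ℂ →+* ℂ, (∀ z, φ (cexp z) = cexp (φ z)) ∧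
      φ (2 * Real.pi * I) = 2 * Real.pi * I ∧ φ I = I ∧ φ Real.pi = Real.pi ∧
      (∀ β : ℝ, (∃ r : ℚ, β ^ 2 = r) → φ β = β) ∧
      ∃ m : ℤ, m ≠ 0 ∧ φ ℓ = ℓ + m * (2 * Real.pi * I) := by
  obtain ⟨ρ, hρ, hρτ, m, hm0, hρℓ⟩ := exists_expEnd_fix_two_pi_I σ hσ hℓ hmove
  refine ⟨ρ.comp ρ, ?_, ?_, ?_, ?_, ?_, 2 * m, by omega, ?_⟩
  · intro z
    rw [RingHom.comp_apply, RingHom.comp_apply, hρ, hρ]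
  · rw [RingHom.comp_apply, hρτ, hρτ]
  · rcases ringHom_apply_I ρ with h | h <;> simp [RingHom.comp_apply, h]
  · rcases expEnd_apply_pi ρ hρ with h | h <;> simp [RingHom.comp_apply, h]
  · rintro β ⟨r, hr⟩
    have hβc : ((β : ℂ)) ^ 2 = (r : ℂ) := by
      have h1 : ((β ^ 2 : ℝ) : ℂ) = ((r : ℝ) : ℂ) := by rw [hr]
      push_cast at h1
      exact h1
    have h1 : (ρ β) ^ 2 = (β : ℂ) ^ 2 := by rw [← map_pow, hβc, map_ratCast]
    rcases sq_eq_sq_iff_eq_or_eq_neg.mp h1 with h | h <;>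
      simp [RingHom.comp_apply, h]
  · rw [RingHom.comp_apply, hρℓ, map_add, map_mul, map_intCast, hρτ, hρℓ]
    push_cast
    ring

/-- **Twisted pairs.** Let `φ ∈ End(ℂ_exp)` fix `2πi`, translate `ℓ` by `m·2πi ≠ 0` and fix the
irrational real `β`. If `φ` translates `x` by a `φ`-fixed `b` (e.g. `b = 0`) and `x` has an
algebraically independent partner, then `e^{βℓ}` and `x` are algebraically independent: `φ` shears
`x` and twists `e^{βℓ}` by the infinite-order unit `e^{β m 2πi}`. [this file] -/
theorem algebraicIndependent_exp_mul_of_expEnd (φ : ℂ →+* ℂ) (hφ : ∀ z, φ (cexp z) = cexp (φ z))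
    (hφτ : φ (2 * Real.pi * I) = 2 * Real.pi * I) {ℓ x b w : ℂ} {β : ℝ} {m : ℤ} (hm : m ≠ 0)
    (hℓ : φ ℓ = ℓ + m * (2 * Real.pi * I)) (hβ : Irrational β) (hφβ : φ β = β)
    (hx : φ x = x + b) (hb : φ b = b) (hw : AlgebraicIndependent ℚ ![w, x]) :
    AlgebraicIndependent ℚ ![cexp (β * ℓ), x] := by
  have hτ0 : (2 * Real.pi * I : ℂ) ≠ 0 := by simp [Real.pi_ne_zero, I_ne_zero]
  have ha : φ ((m : ℂ) * (2 * Real.pi * I)) = m * (2 * Real.pi * I) := by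
    rw [map_mul, map_intCast, hφτ]
  have hy : φ (cexp (β * ℓ)) = cexp (β * (m * (2 * Real.pi * I))) * cexp (β * ℓ) := by
    rw [hφ, map_mul, hφβ, hℓ, mul_add, Complex.exp_add, mul_comm]
  have hu : φ (cexp (β * (m * (2 * Real.pi * I)))) = cexp (β * (m * (2 * Real.pi * I))) := by
    rw [hφ, map_mul, hφβ, ha]
  have hroot : ∀ n : ℕ, 0 < n → cexp (β * (m * (2 * Real.pi * I))) ^ n ≠ 1 := by
    intro n hn h1
    rw [← Complex.exp_nat_mul, Complex.exp_eq_one_iff] at h1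
    obtain ⟨N, hN⟩ := h1
    have h3 : ((n : ℂ) * β * m) * (2 * Real.pi * I) = (N : ℂ) * (2 * Real.pi * I) := by
      rw [← hN]
      ring
    have h4 := mul_right_cancel₀ hτ0 h3
    have h5 : (n : ℝ) * β * m = N := by exact_mod_cast h4
    have hden : ((n : ℝ) * m) ≠ 0 :=
      mul_ne_zero (by exact_mod_cast hn.ne') (by exact_mod_cast hm)
    apply hβ
    refine ⟨(N : ℚ) / (n * m), ?_⟩
    push_cast
    rw [div_eq_iff hden, ← h5]
    ring
  exact algebraicIndependent_of_shear_twist φ hx hb hy hu (Complex.exp_ne_zero _) hroot hw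

/-- `e = exp 1` is transcendental (from the tree's Lindemann–Weierstrass). [Hermite 1873] -/
private theorem soloCexpOne_transcendental : Transcendental ℚ (cexp 1) := by
  have hli : LinearIndependent ℚ ![(1 : ℂ)] := by
    rw [linearIndependent_unique_iff]
    simp
  have h := Literature.NumberTheory.Transcendental.algebraicIndependent_exp_holds
    ![(1 : ℂ)] (fun i => by simpa using isAlgebraic_one) hli
  have h2 := (algebraicIndependent_unique_type_iff (R := ℚ)).mp h
  simpa using h2

/-- `π` is transcendental, as a complex number (from Nesterenko's pair in the tree). -/
private theorem soloPi_transcendental : Transcendental ℚ (Real.pi : ℂ) := by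
  simpa using Literature.Barriers.Schanuel.algebraicIndependent_pi_cexp_pi.transcendental 0

/-- **Theorem O (v).** If ONE endomorphism of `ℂ_exp` moves `log 2`, then `2^{√2} = e^{√2 log 2}`
is algebraically independent from each of `log 2`, `π`, `e` and `log 3`. [this file] -/
theorem two_rpow_sqrt_two_indep_of_expEnd_moves_log_two
    (h : ∃ σ : ℂ →+* ℂ, (∀ z, σ (cexp z) = cexp (σ z)) ∧
      σ ((Real.log 2 : ℝ) : ℂ) ≠ ((Real.log 2 : ℝ) : ℂ)) :
    AlgebraicIndependent ℚ
        ![cexp ((Real.sqrt 2 : ℝ) * ((Real.log 2 : ℝ) : ℂ)), ((Real.log 2 : ℝ) : ℂ)] ∧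
      AlgebraicIndependent ℚ ![cexp ((Real.sqrt 2 : ℝ) * ((Real.log 2 : ℝ) : ℂ)), (Real.pi : ℂ)] ∧
      AlgebraicIndependent ℚ ![cexp ((Real.sqrt 2 : ℝ) * ((Real.log 2 : ℝ) : ℂ)), cexp 1] ∧
      AlgebraicIndependent ℚ
        ![cexp ((Real.sqrt 2 : ℝ) * ((Real.log 2 : ℝ) : ℂ)), ((Real.log 3 : ℝ) : ℂ)] := by
  obtain ⟨σ, hσ, hmove⟩ := h
  have hℓ2 : Real.exp (Real.log ((2 : ℚ) : ℝ)) = (2 : ℚ) := Real.exp_log (by norm_num)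
  have hℓ3 : Real.exp (Real.log ((3 : ℚ) : ℝ)) = (3 : ℚ) := Real.exp_log (by norm_num)
  have hmove' : σ ((Real.log ((2 : ℚ) : ℝ) : ℝ) : ℂ) ≠ ((Real.log ((2 : ℚ) : ℝ) : ℝ) : ℂ) := by
    simpa using hmove
  obtain ⟨φ, hφ, hφτ, -, hφπ, hφβ, m, hm, hφℓ⟩ := exists_expEnd_normal_form σ hσ hℓ2 hmove'
  have hsq : φ (Real.sqrt 2 : ℝ) = Real.sqrt 2 :=
    hφβ _ ⟨2, by rw [Real.sq_sqrt (by norm_num : (0 : ℝ) ≤ 2)]; norm_num⟩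
  have hφℓ' : φ ((Real.log 2 : ℝ) : ℂ) = ((Real.log 2 : ℝ) : ℂ) + m * (2 * Real.pi * I) := by
    simpa using hφℓ
  have hirr : Irrational (Real.sqrt 2) := irrational_sqrt_two
  -- partners
  have ht2 : Transcendental ℚ ((Real.log 2 : ℝ) : ℂ) := by
    simpa using transcendental_log_ratCast (q := 2) (by norm_num) (by norm_num)
  have ht3 : Transcendental ℚ ((Real.log 3 : ℝ) : ℂ) := by
    simpa using transcendental_log_ratCast (q := 3) (by norm_num) (by norm_num)
  obtain ⟨w₂, hw₂⟩ := exists_algebraicIndependent_pair_of_transcendental ht2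
  obtain ⟨wπ, hwπ⟩ := exists_algebraicIndependent_pair_of_transcendental soloPi_transcendental
  obtain ⟨wₑ, hwₑ⟩ := exists_algebraicIndependent_pair_of_transcendental soloCexpOne_transcendental
  obtain ⟨w₃, hw₃⟩ := exists_algebraicIndependent_pair_of_transcendental ht3
  obtain ⟨m₃, hm₃⟩ := expEnd_apply_log φ hφ hℓ3
  have hφ3 : φ ((Real.log 3 : ℝ) : ℂ) = ((Real.log 3 : ℝ) : ℂ) + m₃ * (2 * Real.pi * I) := by
    simpa using hm₃
  refine ⟨?_, ?_, ?_, ?_⟩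
  · exact algebraicIndependent_exp_mul_of_expEnd φ hφ hφτ hm hφℓ' hirr hsq hφℓ'
      (by rw [map_mul, map_intCast, hφτ]) hw₂
  · exact algebraicIndependent_exp_mul_of_expEnd φ hφ hφτ hm hφℓ' hirr hsq (b := 0)
      (by rw [hφπ, add_zero]) (map_zero φ) hwπ
  · exact algebraicIndependent_exp_mul_of_expEnd φ hφ hφτ hm hφℓ' hirr hsq (b := 0)
      (by rw [expEnd_apply_exp_one φ hφ, add_zero]) (map_zero φ) hwₑ
  · exact algebraicIndependent_exp_mul_of_expEnd φ hφ hφτ hm hφℓ' hirr hsq hφ3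
      (by rw [map_mul, map_intCast, hφτ]) hw₃

/-- **SC(2) at the sixth emblematic pair `(log 2, √2 log 2)`** — equivalently `log 2 ⟂ 2^{√2}` —
IF some endomorphism of `ℂ_exp` moves `log 2`. [this file] -/
theorem schanuel_pair_log_two_sqrt_two_of_expEnd_moves
    (h : ∃ σ : ℂ →+* ℂ, (∀ z, σ (cexp z) = cexp (σ z)) ∧
      σ ((Real.log 2 : ℝ) : ℂ) ≠ ((Real.log 2 : ℝ) : ℂ)) :
    AlgebraicIndependent ℚ
        ![((Real.log 2 : ℝ) : ℂ), cexp ((Real.sqrt 2 : ℝ) * ((Real.log 2 : ℝ) : ℂ))] ∧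
      (2 : Cardinal) ≤ Algebra.trdeg ℚ
        ↥(expField ![((Real.log 2 : ℝ) : ℂ), (Real.sqrt 2 : ℝ) * ((Real.log 2 : ℝ) : ℂ)]) := by
  have h1 := (two_rpow_sqrt_two_indep_of_expEnd_moves_log_two h).1
  have hAI : AlgebraicIndependent ℚ
      ![((Real.log 2 : ℝ) : ℂ), cexp ((Real.sqrt 2 : ℝ) * ((Real.log 2 : ℝ) : ℂ))] := by
    have h2 := h1.comp ![(1 : Fin 2), 0] (by decide)
    have e : ![cexp ((Real.sqrt 2 : ℝ) * ((Real.log 2 : ℝ) : ℂ)), ((Real.log 2 : ℝ) : ℂ)] ∘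
        ![(1 : Fin 2), 0] =
        ![((Real.log 2 : ℝ) : ℂ), cexp ((Real.sqrt 2 : ℝ) * ((Real.log 2 : ℝ) : ℂ))] := by
      funext i
      fin_cases i <;> rfl
    rw [e] at h2
    exact h2
  refine ⟨hAI, le_trdeg_expField_of_algebraicIndependent (n := 2) hAI
    (Fin.forall_fin_two.mpr ⟨?_, ?_⟩)⟩
  · simpa using self_mem_expField
      ![((Real.log 2 : ℝ) : ℂ), (Real.sqrt 2 : ℝ) * ((Real.log 2 : ℝ) : ℂ)] 0
  · simpa using exp_mem_expField
      ![((Real.log 2 : ℝ) : ℂ), (Real.sqrt 2 : ℝ) * ((Real.log 2 : ℝ) : ℂ)] 1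

/-- **Headline (Theorem O, all four logarithmic pairs).** If ONE endomorphism of `ℂ_exp` moves
`log 2`, then Schanuel's conjecture holds, in the summit's format `2 ≤ trdeg_ℚ ℚ(z, e^z)`, at all
four logarithmic emblematic open pairs `(iπ, log 2)`, `(1, log 2)`, `(log 2, log 3)`,
`(log 2, √2 log 2)` — whereas at `(1, iπ)` and `(1, e)` every endomorphism of `ℂ_exp` is inert
(part I, `expEnd_fixes_e_expe_pm_pi`). [this file] -/
theorem schanuel_four_log_pairs_of_expEnd_moves_log_two
    (h : ∃ σ : ℂ →+* ℂ, (∀ z, σ (cexp z) = cexp (σ z)) ∧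
      σ ((Real.log 2 : ℝ) : ℂ) ≠ ((Real.log 2 : ℝ) : ℂ)) :
    (2 : Cardinal) ≤ Algebra.trdeg ℚ ↥(expField ![(Real.pi : ℂ) * I, ((Real.log 2 : ℝ) : ℂ)]) ∧
      (2 : Cardinal) ≤ Algebra.trdeg ℚ ↥(expField ![(1 : ℂ), ((Real.log 2 : ℝ) : ℂ)]) ∧
      (2 : Cardinal) ≤ Algebra.trdeg ℚ
        ↥(expField ![((Real.log 2 : ℝ) : ℂ), ((Real.log 3 : ℝ) : ℂ)]) ∧
      (2 : Cardinal) ≤ Algebra.trdeg ℚ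
        ↥(expField ![((Real.log 2 : ℝ) : ℂ), (Real.sqrt 2 : ℝ) * ((Real.log 2 : ℝ) : ℂ)]) := by
  have h3 := schanuel_three_pairs_of_expEnd_moves_log_two h
  exact ⟨h3.1, h3.2.1, h3.2.2, (schanuel_pair_log_two_sqrt_two_of_expEnd_moves h).2⟩

end Summit.Schanuel.Schanuel.Theorems
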